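import Literature.NumberTheory.Automorphic.HeckeFixedVectorsSimple
import Literature.NumberTheory.Automorphic.JacquetLemma
import Mathlib.Topology.Algebra.OpenSubgroup
import Mathlib.Data.Set.Card
import HarnessLib

/-!
# The averaging projector `e_H` of a compact subgroup on a smooth representation

Topic `NumberTheory/Automorphic`, namespace `Literature.NumberTheory.Automorphic.SmoothProjector`.
Infrastructure for the proof of Jacquet's admissibility theorem for `GL_n(F)`
(`Literature.NumberTheory.Automorphic.jacquetAdmissibility_gl`, Bernstein–Zelevinsky 1976,
Thm. 3.25): the operator `π(e_H) v = ∫_H π(h) v dh` of a compact subgroup `H` (Haar probability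
measure) on a smooth representation, realised WITHOUT measure theory as the average of the finite
orbit `{π(h) v : h ∈ H}` (Bernstein–Zelevinsky 1976, §2.1–2.3; Casselman 1995, §2.1, "essentially
a finite sum"; Bump 1997, §4.2, the idempotents `ε_K`).

## Main definitions and results (all proved)

* `orbitSet ρ H v = {ρ h v | h ∈ H}` and `avg ρ H v = |orbitSet|⁻¹ • ∑_{y ∈ orbitSet} y`.
* `avg_eq_index_inv_smul_finsum`: for every finite-index subgroup `B ≤ H` fixing `v`,
  `avg ρ H v = [H:B]⁻¹ • ∑_{q ∈ H/B} ρ(q̃) v` (independence of the averaging subgroup).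
* linearity on smooth vectors (`avg_add`, `avg_smul`, the linear map `avgLinear`), values in
  `V^H` (`avg_mem_fixedPoints`), `avg = id` on `V^H`, `H`-invariance (`avg_apply_of_mem`),
  conjugation (`apply_avg_eq_avg_map_conj`: `ρ(g) e_H = e_{gHg⁻¹} ρ(g)`), transitivity
  (`avg_avg_of_le`: `e_H e_B = e_H` for `B ≤ H`) and the factorisation rule
  (`avg_eq_avg_of_coe_eq_mul`: if `H = U · P` and `P` fixes `v` then `e_H v = e_U v`), which is
  the form in which the Iwahori factorisation enters Jacquet's first lemma
  (Casselman 1995, Thm. 3.3.4; Bernstein–Zelevinsky 1976, §3.16).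

## References

* I. N. Bernstein, A. V. Zelevinsky, *Representations of the group GL(n, F) where F is a
  non-archimedean local field*, Russian Math. Surveys 31:3 (1976), 1–68, §§2.1–2.3, §3.16.
* W. Casselman, *Introduction to the theory of admissible representations of p-adic reductive
  groups* (1995 notes), §2.1, §3.3.
* D. Bump, *Automorphic Forms and Representations* (1997), §4.2.
-/

open scoped Pointwise

namespace Literature.NumberTheory.Automorphic.SmoothProjector

open _root_.Representation

section Orbit

variable {k G V : Type*} [Field k] [Group G] [AddCommGroup V] [Module k V]
  (ρ : Representation k G V) (H : Subgroup G) (v : V)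

/-- The orbit `{ρ h v | h ∈ H}` of the vector `v` under the subgroup `H`, as a subset of `V`.
(Casselman 1995, §2.1.) [folklore] -/
def orbitSet : Set V := (fun g : G => ρ g v) '' (H : Set G)

/-- The **averaging operator** `e_H v = |H v|⁻¹ • ∑_{y ∈ H v} y`: the average of the orbit of
`v` under `H` (junk value `0` when the orbit is infinite). For a compact subgroup `H` and a smooth
vector `v` this is `∫_H ρ(h) v dh` for the Haar probability measure of `H`
(Bernstein–Zelevinsky 1976, §2.3; Casselman 1995, §2.1; Bump 1997, §4.2). [folklore] -/
noncomputable def avg : V := ((orbitSet ρ H v).ncard : k)⁻¹ • ∑ᶠ y ∈ orbitSet ρ H v, y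

variable {ρ H v}

/-- Membership in the orbit set. [folklore] -/
theorem mem_orbitSet_iff {y : V} : y ∈ orbitSet ρ H v ↔ ∃ h ∈ H, ρ h v = y := by
  simp [orbitSet]

/-- `v` lies in its own orbit. [folklore] -/
theorem self_mem_orbitSet : v ∈ orbitSet ρ H v :=
  mem_orbitSet_iff.2 ⟨1, H.one_mem, by simp⟩

/-- The orbit of `ρ h v`, `h ∈ H`, is the orbit of `v`. [folklore] -/
theorem orbitSet_apply_of_mem {h : G} (hh : h ∈ H) : orbitSet ρ H (ρ h v) = orbitSet ρ H v := by
  ext y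
  simp only [mem_orbitSet_iff]
  constructor
  · rintro ⟨h', hh', rfl⟩
    exact ⟨h' * h, H.mul_mem hh' hh, by rw [map_mul, Module.End.mul_apply]⟩
  · rintro ⟨h', hh', rfl⟩
    refine ⟨h' * h⁻¹, H.mul_mem hh' (H.inv_mem hh), ?_⟩
    rw [map_mul, Module.End.mul_apply, ρ.inv_self_apply]

/-- The orbit of `ρ g v` under `g H g⁻¹` is the image under `ρ g` of the orbit of `v` under `H`.
[folklore] -/
theorem orbitSet_map_conj (g : G) :
    orbitSet ρ (H.map (MulAut.conj g).toMonoidHom) (ρ g v) = ρ g '' orbitSet ρ H v := by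
  ext y
  simp only [mem_orbitSet_iff, Set.mem_image]
  constructor
  · rintro ⟨h', hh', rfl⟩
    obtain ⟨h, hh, rfl⟩ := Subgroup.mem_map.1 hh'
    refine ⟨ρ h v, ⟨h, hh, rfl⟩, ?_⟩
    simp only [MulEquiv.coe_toMonoidHom, MulAut.conj_apply, map_mul, Module.End.mul_apply,
      ρ.inv_self_apply]
  · rintro ⟨y, ⟨h, hh, rfl⟩, rfl⟩
    refine ⟨g * h * g⁻¹, Subgroup.mem_map.2 ⟨h, hh, rfl⟩, ?_⟩
    simp only [map_mul, Module.End.mul_apply, ρ.inv_self_apply]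

/-- **Factorisation rule for orbits**: if `H = U · P` as sets with `U ≤ H` and `P` fixing `v`,
the orbits of `v` under `H` and under `U` agree. [folklore] -/
theorem orbitSet_eq_of_coe_eq_mul {U P : Subgroup G} (hU : U ≤ H)
    (hHUP : (H : Set G) = (U : Set G) * (P : Set G)) (hP : ∀ p ∈ P, ρ p v = v) :
    orbitSet ρ H v = orbitSet ρ U v := by
  ext y
  simp only [mem_orbitSet_iff]
  constructor
  · rintro ⟨h, hh, rfl⟩
    have hh' : h ∈ (H : Set G) := hh
    rw [hHUP] at hh'
    obtain ⟨u, hu, p, hp, rfl⟩ := Set.mem_mul.1 hh'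
    exact ⟨u, hu, by rw [map_mul, Module.End.mul_apply, hP p hp]⟩
  · rintro ⟨u, hu, rfl⟩
    exact ⟨u, hU hu, rfl⟩

/-- The averaging operator only depends on the orbit. [folklore] -/
theorem avg_congr_of_orbitSet_eq {H' : Subgroup G} {v' : V}
    (h : orbitSet ρ H v = orbitSet ρ H' v') : avg ρ H v = avg ρ H' v' := by
  simp only [avg, h]

/-- `e_H (ρ h v) = e_H v` for `h ∈ H`. [folklore] -/
theorem avg_apply_of_mem {h : G} (hh : h ∈ H) : avg ρ H (ρ h v) = avg ρ H v :=
  avg_congr_of_orbitSet_eq (orbitSet_apply_of_mem hh)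

/-- **Factorisation rule** (the form in which an Iwahori factorisation is used): if
`H = U · P` with `U ≤ H` and `P` fixing `v`, then `e_H v = e_U v`
(Casselman 1995, proof of Thm. 3.3.4: `P_{K} v = P_{N_0} v` for `v` fixed by `M_0 N_0⁻`).
[folklore] -/
theorem avg_eq_avg_of_coe_eq_mul {U P : Subgroup G} (hU : U ≤ H)
    (hHUP : (H : Set G) = (U : Set G) * (P : Set G)) (hP : ∀ p ∈ P, ρ p v = v) :
    avg ρ H v = avg ρ U v :=
  avg_congr_of_orbitSet_eq (orbitSet_eq_of_coe_eq_mul hU hHUP hP)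

/-- **Conjugation rule**: `ρ(g) (e_H v) = e_{gHg⁻¹} (ρ(g) v)`. [folklore] -/
theorem apply_avg_eq_avg_map_conj (hfin : (orbitSet ρ H v).Finite) (g : G) :
    ρ g (avg ρ H v) = avg ρ (H.map (MulAut.conj g).toMonoidHom) (ρ g v) := by
  have hinj : Set.InjOn (ρ g) (orbitSet ρ H v) := fun x _ y _ hxy => (ρ.apply_bijective g).1 hxy
  rw [avg, avg, orbitSet_map_conj, hinj.ncard_image, map_smul, finsum_mem_image hinj]
  congr 1
  exact (ρ g).toAddMonoidHom.map_finsum_mem _ hfin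

end Orbit

section Coset

variable {k G V : Type*} [Field k] [Group G] [AddCommGroup V] [Module k V]
  (ρ : Representation k G V) (H : Subgroup G) (v : V)

/-- The stabiliser of `v` in `H`, as a subgroup of `↥H`. [folklore] -/
abbrev stabIn : Subgroup H := (ρ.stabilizerSubgroup v).subgroupOf H

variable {ρ H v}

/-- `ρ (q̃) v` only depends on the coset `q ∈ H / Stab_H(v)`: for `h ∈ H`,
`ρ ((h Stab_H(v))~) v = ρ h v`. [folklore] -/
theorem apply_out_mk_eq (h : H) :
    ρ ((QuotientGroup.mk (s := stabIn ρ H v) h).out : G) v = ρ (h : G) v := by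
  obtain ⟨a, ha⟩ := QuotientGroup.mk_out_eq_mul (stabIn ρ H v) h
  rw [ha, Subgroup.coe_mul, map_mul, Module.End.mul_apply]
  have : ρ ((a : H) : G) v = v := Subgroup.mem_subgroupOf.1 a.2
  rw [this]

/-- The orbit of `v` under `H` is parametrised by `H / Stab_H(v)`. [folklore] -/
theorem orbitSet_eq_range :
    orbitSet ρ H v = Set.range fun q : H ⧸ stabIn ρ H v => ρ (q.out : G) v := by
  ext y
  simp only [mem_orbitSet_iff, Set.mem_range]
  constructor
  · rintro ⟨h, hh, rfl⟩
    exact ⟨QuotientGroup.mk ⟨h, hh⟩, apply_out_mk_eq ⟨h, hh⟩⟩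
  · rintro ⟨q, rfl⟩
    exact ⟨q.out, (q.out).2, rfl⟩

/-- The parametrisation of the orbit by `H / Stab_H(v)` is injective. [folklore] -/
theorem injective_apply_out :
    Function.Injective fun q : H ⧸ stabIn ρ H v => ρ (q.out : G) v := by
  intro q q' hqq'
  simp only at hqq'
  rw [← QuotientGroup.out_eq' q, ← QuotientGroup.out_eq' q', QuotientGroup.eq]
  refine Subgroup.mem_subgroupOf.2 ?_
  rw [mem_stabilizerSubgroup, Subgroup.coe_mul, Subgroup.coe_inv, map_mul, Module.End.mul_apply,
    ← hqq', ρ.inv_self_apply]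

/-- The orbit has `[H : Stab_H(v)]` elements. [folklore] -/
theorem ncard_orbitSet : (orbitSet ρ H v).ncard = (stabIn ρ H v).index := by
  rw [orbitSet_eq_range, Set.ncard_range_of_injective injective_apply_out]
  rfl

/-- The averaging operator as a coset sum over `H / Stab_H(v)`. [folklore] -/
theorem avg_eq_stabIn :
    avg ρ H v = (((stabIn ρ H v).index : ℕ) : k)⁻¹ •
      ∑ᶠ q : H ⧸ stabIn ρ H v, ρ (q.out : G) v := by
  rw [avg, ncard_orbitSet, orbitSet_eq_range, finsum_mem_range injective_apply_out]

/-- **Independence of the averaging subgroup.** For every finite-index subgroup `B ≤ H` fixing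
`v`, `e_H v = [H:B]⁻¹ • ∑_{q ∈ H/B} ρ(q̃) v` (Bump 1997, §4.2, proof of Prop. 4.2.3; this is
why `∫_H ρ(h) v dh` may be computed on any such `B`). [folklore] -/
theorem avg_eq_index_inv_smul_finsum [CharZero k] (B : Subgroup H) [B.FiniteIndex]
    (hB : B ≤ stabIn ρ H v) :
    avg ρ H v = ((B.index : ℕ) : k)⁻¹ • ∑ᶠ q : H ⧸ B, ρ (q.out : G) v := by
  haveI : (stabIn ρ H v).FiniteIndex := Subgroup.finiteIndex_of_le hB
  have hfix : v ∈ Representation.fixedPoints (ρ.comp H.subtype) (stabIn ρ H v) := by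
    rw [Representation.mem_fixedPoints]
    intro a ha
    exact Subgroup.mem_subgroupOf.1 ha
  have h := finsum_apply_out_eq_relIndex_smul (ρ.comp H.subtype) hB hfix
  change ∑ᶠ c : H ⧸ B, ρ (c.out : G) v =
    B.relIndex (stabIn ρ H v) • ∑ᶠ d : H ⧸ stabIn ρ H v, ρ (d.out : G) v at h
  rw [avg_eq_stabIn, h, ← Nat.cast_smul_eq_nsmul k, smul_smul, ← B.relIndex_mul_index hB,
    Nat.cast_mul, mul_inv]
  congr 1
  have hr : ((B.relIndex (stabIn ρ H v) : ℕ) : k) ≠ 0 := by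
    rw [Nat.cast_ne_zero]
    intro h0
    have := Subgroup.FiniteIndex.index_ne_zero (H := B)
    rw [← B.relIndex_mul_index hB, h0, zero_mul] at this
    exact this rfl
  field_simp

end Coset

section Smooth

variable {k G V : Type*} [Field k] [Group G] [TopologicalSpace G]
  [IsTopologicalGroup G] [AddCommGroup V] [Module k V]
  {ρ : Representation k G V} {H : Subgroup G}

/-- For `H` compact and `v` smooth, the stabiliser of `v` has finite index in `H`. [folklore] -/
theorem finiteIndex_stabIn (hH : IsCompact (H : Set G)) {v : V} (hv : ρ.IsSmoothVector v) :
    (stabIn ρ H v).FiniteIndex := by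
  haveI : CompactSpace H := isCompact_iff_compactSpace.mp hH
  haveI : Finite (H ⧸ stabIn ρ H v) :=
    Subgroup.quotient_finite_of_isOpen _ (Subgroup.subgroupOf_isOpen H _ hv)
  exact Subgroup.finiteIndex_of_finite_quotient

/-- For `H` compact and `v` smooth the orbit `H v` is finite (Casselman 1995, §2.1). [folklore] -/
theorem finite_orbitSet (hH : IsCompact (H : Set G)) {v : V} (hv : ρ.IsSmoothVector v) :
    (orbitSet ρ H v).Finite :=
  JacquetLemma.finite_orbit_of_isSmoothVector ρ H hH subset_rfl hv

variable [CharZero k]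

/-- **Additivity** of `e_H` on smooth vectors (compute all three averages on
`Stab_H(v) ∩ Stab_H(w)`). [folklore] -/
theorem avg_add (hH : IsCompact (H : Set G)) {v w : V} (hv : ρ.IsSmoothVector v)
    (hw : ρ.IsSmoothVector w) : avg ρ H (v + w) = avg ρ H v + avg ρ H w := by
  haveI := finiteIndex_stabIn hH hv
  haveI := finiteIndex_stabIn hH hw
  set B : Subgroup H := stabIn ρ H v ⊓ stabIn ρ H w with hBdef
  haveI : B.FiniteIndex := by rw [hBdef]; infer_instance
  haveI : Fintype (H ⧸ B) := Fintype.ofFinite _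
  have hBv : B ≤ stabIn ρ H v := inf_le_left
  have hBw : B ≤ stabIn ρ H w := inf_le_right
  have hBvw : B ≤ stabIn ρ H (v + w) := by
    intro b hb
    refine Subgroup.mem_subgroupOf.2 ?_
    rw [mem_stabilizerSubgroup, map_add, Subgroup.mem_subgroupOf.1 (hBv hb),
      Subgroup.mem_subgroupOf.1 (hBw hb)]
  rw [avg_eq_index_inv_smul_finsum B hBvw, avg_eq_index_inv_smul_finsum B hBv,
    avg_eq_index_inv_smul_finsum B hBw, finsum_eq_sum_of_fintype, finsum_eq_sum_of_fintype,
    finsum_eq_sum_of_fintype, ← smul_add, ← Finset.sum_add_distrib]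
  congr 1
  exact Finset.sum_congr rfl fun q _ => map_add _ _ _

/-- **Homogeneity** of `e_H` on smooth vectors. [folklore] -/
theorem avg_smul (hH : IsCompact (H : Set G)) (c : k) {v : V} (hv : ρ.IsSmoothVector v) :
    avg ρ H (c • v) = c • avg ρ H v := by
  haveI := finiteIndex_stabIn hH hv
  haveI : Fintype (H ⧸ stabIn ρ H v) := Fintype.ofFinite _
  have hB : stabIn ρ H v ≤ stabIn ρ H (c • v) := by
    intro b hb
    refine Subgroup.mem_subgroupOf.2 ?_
    rw [mem_stabilizerSubgroup, map_smul, Subgroup.mem_subgroupOf.1 hb]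
  rw [avg_eq_index_inv_smul_finsum (stabIn ρ H v) hB,
    avg_eq_index_inv_smul_finsum (stabIn ρ H v) le_rfl, finsum_eq_sum_of_fintype,
    finsum_eq_sum_of_fintype, smul_comm]
  congr 1
  rw [Finset.smul_sum]
  exact Finset.sum_congr rfl fun q _ => map_smul _ _ _

/-- `e_H v ∈ V^H` for `H` compact and `v` smooth (Casselman 1995, §2.1). [folklore] -/
theorem avg_mem_fixedPoints (hH : IsCompact (H : Set G)) {v : V} (hv : ρ.IsSmoothVector v) :
    avg ρ H v ∈ ρ.fixedPoints H := by
  haveI := finiteIndex_stabIn hH hv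
  have hfix : v ∈ Representation.fixedPoints (ρ.comp H.subtype) (stabIn ρ H v) := by
    rw [Representation.mem_fixedPoints]
    intro a ha
    exact Subgroup.mem_subgroupOf.1 ha
  have h := finsum_apply_out_mem_invariants (ρ.comp H.subtype) (stabIn ρ H v) hfix
  rw [avg_eq_index_inv_smul_finsum (stabIn ρ H v) le_rfl]
  exact Submodule.smul_mem _ _ h

omit [TopologicalSpace G] [IsTopologicalGroup G] [CharZero k] in
/-- The orbit of an `H`-fixed vector is a singleton. [folklore] -/
theorem orbitSet_eq_singleton {v : V} (hv : v ∈ ρ.fixedPoints H) : orbitSet ρ H v = {v} := by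
  rw [Representation.mem_fixedPoints] at hv
  ext y
  simp only [mem_orbitSet_iff, Set.mem_singleton_iff]
  constructor
  · rintro ⟨h, hh, rfl⟩
    exact hv h hh
  · rintro rfl
    exact ⟨1, H.one_mem, by simp⟩

omit [TopologicalSpace G] [IsTopologicalGroup G] [CharZero k] in
/-- `e_H v = v` for `v ∈ V^H`. [folklore] -/
theorem avg_eq_self_of_mem_fixedPoints {v : V} (hv : v ∈ ρ.fixedPoints H) : avg ρ H v = v := by
  rw [avg, orbitSet_eq_singleton hv, Set.ncard_singleton, finsum_mem_singleton, Nat.cast_one,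
    inv_one, one_smul]

omit [TopologicalSpace G] [IsTopologicalGroup G] [CharZero k] in
/-- `e_H 0 = 0`. [folklore] -/
@[simp] theorem avg_zero : avg ρ H (0 : V) = 0 :=
  avg_eq_self_of_mem_fixedPoints (Submodule.zero_mem _)

omit [CharZero k] in
/-- If `g` normalises `H` then `ρ(g)` commutes with `e_H` on smooth vectors. [folklore] -/
theorem apply_avg_of_map_conj_eq (hH : IsCompact (H : Set G)) {g : G}
    (hg : H.map (MulAut.conj g).toMonoidHom = H) {v : V} (hv : ρ.IsSmoothVector v) :
    ρ g (avg ρ H v) = avg ρ H (ρ g v) := by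
  rw [apply_avg_eq_avg_map_conj (finite_orbitSet hH hv), hg]

variable (H) in
/-- **The projector `e_H` as a linear map** on a smooth representation, for `H` compact
(Bernstein–Zelevinsky 1976, §2.3; Bump 1997, §4.2, `π(ε_K)`). [folklore] -/
noncomputable def avgLinear (hρ : ρ.IsSmooth) (hH : IsCompact (H : Set G)) : V →ₗ[k] V where
  toFun := avg ρ H
  map_add' v w := avg_add hH (hρ v) (hρ w)
  map_smul' c v := avg_smul hH c (hρ v)

/-- `avgLinear` is `avg`. [folklore] -/
@[simp] theorem avgLinear_apply (hρ : ρ.IsSmooth) (hH : IsCompact (H : Set G)) (v : V) :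
    avgLinear H hρ hH v = avg ρ H v := rfl

/-- The image of `e_H` is exactly `V^H`. [folklore] -/
theorem range_avgLinear (hρ : ρ.IsSmooth) (hH : IsCompact (H : Set G)) :
    LinearMap.range (avgLinear H hρ hH) = ρ.fixedPoints H := by
  refine le_antisymm ?_ fun v hv => ⟨v, avg_eq_self_of_mem_fixedPoints hv⟩
  rintro _ ⟨v, rfl⟩
  exact avg_mem_fixedPoints hH (hρ v)

/-- **`V^H` is spanned by the averages of any spanning set**: if `S` spans `V` then
`V^H ≤ span (e_H '' S)` (since `e_H` is a linear projection onto `V^H`). This is how finiteness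
of `V^K` is proved from the Cartan decomposition (Bernstein–Zelevinsky 1976, §3.17 ff.). [folklore] -/
theorem fixedPoints_le_span_image_avg (hρ : ρ.IsSmooth) (hH : IsCompact (H : Set G)) {S : Set V}
    (hS : Submodule.span k S = ⊤) : ρ.fixedPoints H ≤ Submodule.span k (avg ρ H '' S) := by
  intro v hv
  have h1 : v ∈ Submodule.map (avgLinear H hρ hH) (Submodule.span k S) := by
    rw [hS, Submodule.map_top, range_avgLinear]
    exact hv
  rwa [Submodule.map_span] at h1

/-- **Transitivity of averaging**: `e_H (e_B v) = e_H v` for `B ≤ H` (average first over the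
small group, then over the large one; Bernstein–Zelevinsky 1976, §2.3). [folklore] -/
theorem avg_avg_of_le (hρ : ρ.IsSmooth) (hH : IsCompact (H : Set G)) {B : Subgroup G}
    (hBH : B ≤ H) (v : V) : avg ρ H (avg ρ B v) = avg ρ H v := by
  have hfin : (orbitSet ρ B v).Finite :=
    JacquetLemma.finite_orbit_of_isSmoothVector ρ B hH hBH (hρ v)
  have hne : (orbitSet ρ B v).ncard ≠ 0 := Set.ncard_ne_zero_of_mem self_mem_orbitSet hfin
  have hconst : ∀ y ∈ orbitSet ρ B v, avg ρ H y = avg ρ H v := by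
    intro y hy
    obtain ⟨b, hb, rfl⟩ := mem_orbitSet_iff.1 hy
    exact avg_apply_of_mem (hBH hb)
  calc avg ρ H (avg ρ B v)
      = avgLinear H hρ hH (((orbitSet ρ B v).ncard : k)⁻¹ • ∑ᶠ y ∈ orbitSet ρ B v, y) := rfl
    _ = ((orbitSet ρ B v).ncard : k)⁻¹ • ∑ᶠ y ∈ orbitSet ρ B v, avgLinear H hρ hH y := by
        rw [map_smul]
        congr 1
        exact (avgLinear H hρ hH).toAddMonoidHom.map_finsum_mem (fun y => y) hfin
    _ = ((orbitSet ρ B v).ncard : k)⁻¹ • ∑ᶠ y ∈ orbitSet ρ B v, avg ρ H v := by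
        congr 1
        exact finsum_mem_congr rfl fun y hy => hconst y hy
    _ = avg ρ H v := by
        rw [finsum_mem_eq_finite_toFinset_sum _ hfin, Finset.sum_const, ← Nat.cast_smul_eq_nsmul k,
          smul_smul, Set.ncard_eq_toFinset_card _ hfin, inv_mul_cancel₀, one_smul]
        rw [← Set.ncard_eq_toFinset_card _ hfin]
        exact Nat.cast_ne_zero.2 hne

/-- If `e_B v = 0` for some `B ≤ H` then `e_H v = 0`. This is how the vanishing of a Jacquet
module is used: `v ∈ V(N)` iff `e_{N₀} v = 0` for some compact open `N₀ ≤ N`, and then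
`e_{N₁} v = 0` for every compact `N₁ ≥ N₀` (Bernstein–Zelevinsky 1976, §2.33; Casselman 1995,
Lemma 3.3.?; Jacquet–Langlands). [folklore] -/
theorem avg_eq_zero_of_le (hρ : ρ.IsSmooth) (hH : IsCompact (H : Set G)) {B : Subgroup G}
    (hBH : B ≤ H) {v : V} (hv : avg ρ B v = 0) : avg ρ H v = 0 := by
  rw [← avg_avg_of_le hρ hH hBH v, hv, avg_zero]


end Smooth

end Literature.NumberTheory.Automorphic.SmoothProjector
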